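import Summits.BirchSwinnertonDyer.BirchSwinnertonDyer.Theses.UniversalToricDescent
import Summits.BirchSwinnertonDyer.BirchSwinnertonDyer.Theorems.PrintCf2SplitBadTwoKatzMeasureValueExists
import Literature.NumberTheory.EllipticCurves.TwoVariableSelmerDual
import Literature.NumberTheory.EllipticCurves.ZpExtensionSplitPrimeLineThroughPair
import Literature.NumberTheory.EllipticCurves.ToricTwoVariablePAdicLFunction
import HarnessLib

/-!
# Sketch (utd-idea g47) — crux idea «epsilon-supply» for K3a `stub_toricExists` of `Lines/thin_comb.lean` v5
# (crux `AdditiveSplitIMCInclusionAtThree`, stmt-BirchSwinnertonDyer-20395, route UniversalToricDescent)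

Everything in this file is PROVED (no `sorry`); it types the two structural findings of LENS-MEMO v47 and the
transfer «natural (ε-normalised) supply ⇒ K3a».

* §1 `IntSeries.hasValueAt₂_of_tendsto` / `UnrSeries.hasValueAt₂_of_tendsto` — **continuity of evaluation on a
  closed polydisc of radius `ρ < 1`**: values of a bounded double series `L ∈ R₀⟦T₁,T₂⟧` pass to limits of points.
  `UnrSeries.hasValueAt₂_zero_of_decay` — (F1-core) **ONE-WEIGHT p-POWER RIGIDITY**: if the values at points
  `(x_j, y_j) → (x₀, y₀)` are `O(‖c‖^{n_j})` with `‖c‖ < 1`, `n_j → ∞`, then `L(x₀, y₀) = 0`.  Consequence (memo §F1,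
  with the identity principle `UnrSeries.eq_zero_of_infinite_zeros₂`): an interpolation formula at a supercuspidal
  `p` whose Euler-type factor carries a power `c^{a}` or `c^{b}` of ONE weight only (the Coates–Perrin-Riou ε-factor
  read with FIXED CM periods) is satisfied by NO nonzero bounded `L₂`; only factors in `a + b` survive.
* §2 `IsToricTwoVarLFunctionScaled c` — the D1 predicate (`IsToricTwoVarLFunction`, p697787) with the value
  multiplied by `c ^ (a + b)` (the shape of the NATURAL factor at a supercuspidal `p`: Hsieh–Marannino
  `𝓘_p = ε(π_{f,p} ⊗ χ₁, ½)⁻¹ = ± α^{-f_p} p^{f_p (a+b)/2}`, the unit `α^{-f_p} = [σ̄]^{-f_p}(r)` pre-absorbed into `L₂`);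
  `IsToricTwoVarLFunctionScaled.of_sq_eq` — **period absorption** `c = μ² ⇒` the D1 predicate at `(Ω_K, μ·Ω_p)`;
  `exists_isToricTwoVarLFunction_of_scaled` — the ∃-transfer (`ℚ̄_p` algebraically closed supplies `μ`).
* §3 `K3aScaled` (the natural supply statement, conclusion `∃ Ω_K Ω_p L₂ c₀ …Scaled`) and
  `K3a_of_K3aScaled : K3aScaled → K3aStatement`, where `K3aStatement` is the type of `stub_toricExists` VERBATIM.

[cite: Marannino2025, Prop. 5.11–5.12 and Remark 27 (arXiv:2312.06565, Doc. Math.; store p0021–p0022)]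
[cite: CastellaWan2023, §2.4 Thm. 2.11 (arXiv:1607.02019)] [cite: Coates1991MotivicPadicL, §(35)–(37) (LMS LN 153)]
-/

set_option linter.dupNamespace false

noncomputable section

open scoped Topology
open Filter NumberField IsDedekindDomain Field
open Literature.NumberTheory.EllipticCurves Literature.NumberTheory.GaloisRepresentations
open Summit.BirchSwinnertonDyer.BirchSwinnertonDyer.Theorems.PrintCf2.KatzMeasureValue

namespace Summit.BirchSwinnertonDyer.BirchSwinnertonDyer.Cruxes.AdditiveSplitIMCInclusionAtThree.EpsilonSupply

variable {p : ℕ} [Fact p.Prime]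

/-! ## §1 Continuity of evaluation on a closed polydisc; one-weight `p`-power rigidity (F1-core) -/

/-- **Continuity of evaluation** (coefficients in `𝒪_{ℂ_p}`): if `G(x_j, y_j) = v_j` with `‖x_j‖, ‖y_j‖ ≤ ρ < 1`,
`x_j → x₀`, `y_j → y₀`, `v_j → v₀`, then `G(x₀, y₀) = v₀`.  (Uniform convergence on the closed polydisc of
radius `ρ`: the terms are dominated by `ρ^{i+j}`.) [cite: Washington1997, §7.2] -/
theorem IntSeries.hasValueAt₂_of_tendsto (G : PowerSeries (PowerSeries (PadicComplexInt p)))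
    {ρ : ℝ} (hρ : ρ < 1) {x y v : ℕ → ℂ_[p]} {x₀ y₀ v₀ : ℂ_[p]}
    (hx : ∀ j, ‖x j‖ ≤ ρ) (hy : ∀ j, ‖y j‖ ≤ ρ)
    (hv : ∀ j, IntSeries.HasValueAt₂ G (x j) (y j) (v j))
    (hx₀ : Tendsto x atTop (𝓝 x₀)) (hy₀ : Tendsto y atTop (𝓝 y₀))
    (hv₀ : Tendsto v atTop (𝓝 v₀)) :
    IntSeries.HasValueAt₂ G x₀ y₀ v₀ := by
  set s : Set (ℂ_[p] × ℂ_[p]) := {q | ‖q.1‖ ≤ ρ ∧ ‖q.2‖ ≤ ρ} with hs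
  have hρ0 : 0 ≤ ρ := (norm_nonneg _).trans (hx 0)
  have hx₀s : ‖x₀‖ ≤ ρ := le_of_tendsto' hx₀.norm hx
  have hy₀s : ‖y₀‖ ≤ ρ := le_of_tendsto' hy₀.norm hy
  let term : ℕ × ℕ → ℂ_[p] × ℂ_[p] → ℂ_[p] := fun k q ↦
    ((PowerSeries.coeff k.2 (PowerSeries.coeff k.1 G) : PadicComplexInt p) : ℂ_[p]) * q.1 ^ k.1 * q.2 ^ k.2
  have hcont : ContinuousOn (fun q ↦ ∑' k, term k q) s := by
    refine continuousOn_tsum (u := fun k : ℕ × ℕ ↦ ρ ^ k.1 * ρ ^ k.2) (fun k ↦ ?_) ?_ ?_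
    · exact ((continuous_const.mul (continuous_fst.pow _)).mul (continuous_snd.pow _)).continuousOn
    · exact (summable_geometric_of_lt_one hρ0 hρ).mul_of_nonneg (summable_geometric_of_lt_one hρ0 hρ)
        (fun _ ↦ pow_nonneg hρ0 _) (fun _ ↦ pow_nonneg hρ0 _)
    · intro k q hq
      exact (norm_term₂_le G q.1 q.2 k).trans
        (mul_le_mul (pow_le_pow_left₀ (norm_nonneg _) hq.1 _) (pow_le_pow_left₀ (norm_nonneg _) hq.2 _)
          (pow_nonneg (norm_nonneg _) _) (pow_nonneg hρ0 _))
  have hsum₀ : Summable fun k ↦ term k (x₀, y₀) :=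
    summable₂_of_norm_lt_one G (hx₀s.trans_lt hρ) (hy₀s.trans_lt hρ)
  have hF : v = fun j ↦ ∑' k, term k (x j, y j) := funext fun j ↦ (hv j).tsum_eq.symm
  have hq : Tendsto (fun j ↦ (x j, y j)) atTop (𝓝[s] (x₀, y₀)) :=
    tendsto_nhdsWithin_iff.mpr ⟨hx₀.prodMk_nhds hy₀, Eventually.of_forall fun j ↦ ⟨hx j, hy j⟩⟩
  have hlim : Tendsto (fun j ↦ ∑' k, term k (x j, y j)) atTop (𝓝 (∑' k, term k (x₀, y₀))) :=
    (hcont (x₀, y₀) ⟨hx₀s, hy₀s⟩).tendsto.comp hq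
  rw [hF] at hv₀
  rw [tendsto_nhds_unique hv₀ hlim]
  exact hsum₀.hasSum

/-- **Continuity of evaluation for `L ∈ R₀⟦T₁,T₂⟧ = Λ_unr`** (transport of `IntSeries.hasValueAt₂_of_tendsto` along
`UnrSeries.hasValueAt₂_iff_toInt₂`). [cite: CastellaWan2023, §2.4 (Λ_unr, arXiv:1607.02019 store p0010)] -/
theorem UnrSeries.hasValueAt₂_of_tendsto (L : PowerSeries (UnrSeries p))
    {ρ : ℝ} (hρ : ρ < 1) {x y v : ℕ → ℂ_[p]} {x₀ y₀ v₀ : ℂ_[p]}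
    (hx : ∀ j, ‖x j‖ ≤ ρ) (hy : ∀ j, ‖y j‖ ≤ ρ)
    (hv : ∀ j, UnrSeries.HasValueAt₂ L (x j) (y j) (v j))
    (hx₀ : Tendsto x atTop (𝓝 x₀)) (hy₀ : Tendsto y atTop (𝓝 y₀))
    (hv₀ : Tendsto v atTop (𝓝 v₀)) :
    UnrSeries.HasValueAt₂ L x₀ y₀ v₀ := by
  rw [UnrSeries.hasValueAt₂_iff_toInt₂]
  exact IntSeries.hasValueAt₂_of_tendsto _ hρ hx hy
    (fun j ↦ (UnrSeries.hasValueAt₂_iff_toInt₂ _ _ _ _).mp (hv j)) hx₀ hy₀ hv₀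

/-- **(F1-core) ONE-WEIGHT `p`-POWER RIGIDITY AT A LIMIT POINT**: if `L(x_j, y_j) = v_j` at points of the closed
polydisc of radius `ρ < 1` accumulating at `(x₀, y₀)` and `‖v_j‖ ≤ C‖c‖^{n_j}` with `‖c‖ < 1`, `n_j → ∞` (the values
carry an unabsorbable power of ONE weight — e.g. the factor `c^{a}` of a Coates–Perrin-Riou ε-normalisation read with
FIXED CM periods along `ψ_j = ψ·λ₀^{p^j t}`, `a_j → ∞`, avatars `r_j → r`), then `L(x₀, y₀) = 0`.  With infinitely many
such limit points on a line the identity principle (`UnrSeries.eq_zero_of_infinite_zeros₂`) gives `L = 0` (memo §F1).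
[cite: CastellaWan2023, §2.4 Thm. 2.11 (arXiv:1607.02019)] [cite: Washington1997, §7.2] -/
theorem UnrSeries.hasValueAt₂_zero_of_decay (L : PowerSeries (UnrSeries p))
    {ρ : ℝ} (hρ : ρ < 1) {x y v : ℕ → ℂ_[p]} {x₀ y₀ : ℂ_[p]}
    (hx : ∀ j, ‖x j‖ ≤ ρ) (hy : ∀ j, ‖y j‖ ≤ ρ)
    (hv : ∀ j, UnrSeries.HasValueAt₂ L (x j) (y j) (v j))
    (hx₀ : Tendsto x atTop (𝓝 x₀)) (hy₀ : Tendsto y atTop (𝓝 y₀))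
    {c : ℂ_[p]} (hc : ‖c‖ < 1) {C : ℝ} {n : ℕ → ℕ} (hn : Tendsto n atTop atTop)
    (hvb : ∀ j, ‖v j‖ ≤ C * ‖c‖ ^ (n j)) :
    UnrSeries.HasValueAt₂ L x₀ y₀ 0 := by
  refine UnrSeries.hasValueAt₂_of_tendsto L hρ hx hy hv hx₀ hy₀ (squeeze_zero_norm hvb ?_)
  simpa using ((tendsto_pow_atTop_nhds_zero_of_lt_one (norm_nonneg c) hc).comp hn).const_mul C

/-! ## §2 The ε-normalised (scaled) toric predicate and period absorption -/

variable {K : Type} [Field K] [NumberField K] {N : ℕ}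

/-- **The toric predicate with an `(a+b)`-power interpolation factor** `c ^ (a + b)` in front of Castella–Wan's
value (D1 `IsToricTwoVarLFunction` verbatim otherwise).  At a supercuspidal `p ∣ N` the natural (Hida /
Coates–Perrin-Riou / Hsieh–Marannino) local factor of the `𝛉`-dominant Rankin–Selberg interpolation is
`ε(π_{f,p} ⊗ χ₁, ½)⁻¹ = w_p · α(ψ)^{-f_p} · p^{f_p(a+b)/2}` with `α(ψ) = r_ψ(σ̄)` the unit root (`σ̄ = rec_𝔭̄(p)|_{K_∞}`),
so after multiplying the constructed function by the unit `w_p[σ̄]^{f_p} ∈ Λ_unr^×` its values have exactly this shape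
with `c = p^{f_p/2}`.  [cite: Marannino2025, Prop. 5.12 (3) and Remark 27 (arXiv:2312.06565 store p0021–p0022)]
[cite: CastellaWan2023, §2.4 Thm. 2.11 (arXiv:1607.02019)] -/
def IsToricTwoVarLFunctionScaled (c : ℂ_[p]) (ι : PadicAlgCl p ≃+* ℂ) (𝔭 𝔭' : HeightOneSpectrum (𝓞 K))
    (κ₁ κ₂ : ZpExtension K p) (γ₁ γ₂ : absoluteGaloisGroup K) (f : CuspForm (CongruenceSubgroup.Gamma0 N) 2)
    (ΩK : ℂ) (Ωp : ℂ_[p]) (L₂ : PowerSeries (UnrSeries p)) : Prop :=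
  ∀ (ψ : HeckeCharacter K) (a b : ℕ), 1 ≤ a → 1 ≤ b →
    ψ.HasInfinityType (fun _ ↦ (a : ℤ)) (fun _ ↦ -(b : ℤ)) →
    (∀ w : HeightOneSpectrum (𝓞 K), ψ.IsUnramifiedAt w) →
    ∀ r : FramedGaloisRep K (PadicAlgCl p) 1, IsPAdicAvatarOf ι ψ r → FactorsThroughPair κ₁ κ₂ r →
    ∀ L : ℂ → ℂ, Differentiable ℂ L →
      (∀ s : ℂ, (a : ℝ) + 2 < s.re → L s = rankinSelbergEulerProductHecke f ψ s) →
      UnrSeries.HasValueAt₂ L₂ (avatarValueAt r γ₁ - 1) (avatarValueAt r γ₂ - 1)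
        (c ^ (a + b) *
          (((ι.symm (toricInterpolationValue p f 𝔭 𝔭' ψ a b ΩK (L 1)) : PadicAlgCl p) : ℂ_[p]) *
            Ωp ^ (2 * (a + b))))

variable {ι : PadicAlgCl p ≃+* ℂ} {𝔭 𝔭' : HeightOneSpectrum (𝓞 K)} {κ₁ κ₂ : ZpExtension K p}
  {γ₁ γ₂ : absoluteGaloisGroup K} {f : CuspForm (CongruenceSubgroup.Gamma0 N) 2} {ΩK : ℂ} {Ωp : ℂ_[p]}
  {L₂ : PowerSeries (UnrSeries p)}

/-- `c = 1` is the D1 predicate. -/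
theorem isToricTwoVarLFunctionScaled_one_iff :
    IsToricTwoVarLFunctionScaled 1 ι 𝔭 𝔭' κ₁ κ₂ γ₁ γ₂ f ΩK Ωp L₂ ↔
      IsToricTwoVarLFunction ι 𝔭 𝔭' κ₁ κ₂ γ₁ γ₂ f ΩK Ωp L₂ := by
  simp only [IsToricTwoVarLFunctionScaled, IsToricTwoVarLFunction, one_pow, one_mul]

/-- **PERIOD ABSORPTION**: an `(a+b)`-power factor `c^{a+b}` with `c = μ²` is absorbed by rescaling the `p`-adic
period, `Ω_p ↦ μ·Ω_p` (the value carries `Ω_p^{2(a+b)}`).  This is why the natural ε-factor at a supercuspidal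
`p` is invisible in the D1-CONE normalisation `𝓔 = 1`. [cite: CastellaWan2023, §2.4 Thm. 2.11 (arXiv:1607.02019)] -/
theorem IsToricTwoVarLFunctionScaled.of_sq_eq {c μ : ℂ_[p]} (hμ : μ ^ 2 = c)
    (h : IsToricTwoVarLFunctionScaled c ι 𝔭 𝔭' κ₁ κ₂ γ₁ γ₂ f ΩK Ωp L₂) :
    IsToricTwoVarLFunction ι 𝔭 𝔭' κ₁ κ₂ γ₁ γ₂ f ΩK (μ * Ωp) L₂ := by
  intro ψ a b ha hb hinf hunr r hr hκ L hLd hLe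
  have hv := h ψ a b ha hb hinf hunr r hr hκ L hLd hLe
  have hpow : (μ * Ωp) ^ (2 * (a + b)) = c ^ (a + b) * Ωp ^ (2 * (a + b)) := by
    rw [mul_pow, ← hμ, ← pow_mul]
  rw [hpow]
  convert hv using 1
  ring

/-- Conversely the D1 predicate at `(Ω_K, μ·Ω_p)` is the scaled predicate with `c = μ²` at `(Ω_K, Ω_p)`. -/
theorem IsToricTwoVarLFunctionScaled.of_isToricTwoVarLFunction {μ : ℂ_[p]}
    (h : IsToricTwoVarLFunction ι 𝔭 𝔭' κ₁ κ₂ γ₁ γ₂ f ΩK (μ * Ωp) L₂) :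
    IsToricTwoVarLFunctionScaled (μ ^ 2) ι 𝔭 𝔭' κ₁ κ₂ γ₁ γ₂ f ΩK Ωp L₂ := by
  intro ψ a b ha hb hinf hunr r hr hκ L hLd hLe
  have hv := h ψ a b ha hb hinf hunr r hr hκ L hLd hLe
  have hpow : (μ * Ωp) ^ (2 * (a + b)) = (μ ^ 2) ^ (a + b) * Ωp ^ (2 * (a + b)) := by
    rw [mul_pow, ← pow_mul]
  rw [hpow] at hv
  convert hv using 1
  ring

/-- **∃-TRANSFER**: a scaled frame with `c = c₀ ∈ ℚ̄_p^×` yields a D1 frame at SOME admissible period pair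
(`μ₀² = c₀` exists in the algebraically closed `ℚ̄_p`; `Ω_p' = μ₀·Ω_p ≠ 0`). -/
theorem exists_isToricTwoVarLFunction_of_scaled {c₀ : PadicAlgCl p} (hc₀ : c₀ ≠ 0)
    (h : ∃ (ΩK : ℂ) (Ωp : ℂ_[p]) (L₂ : PowerSeries (UnrSeries p)), ΩK ≠ 0 ∧ Ωp ≠ 0 ∧
      IsToricTwoVarLFunctionScaled (c₀ : ℂ_[p]) ι 𝔭 𝔭' κ₁ κ₂ γ₁ γ₂ f ΩK Ωp L₂) :
    ∃ (ΩK : ℂ) (Ωp : ℂ_[p]) (L₂ : PowerSeries (UnrSeries p)), ΩK ≠ 0 ∧ Ωp ≠ 0 ∧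
      IsToricTwoVarLFunction ι 𝔭 𝔭' κ₁ κ₂ γ₁ γ₂ f ΩK Ωp L₂ := by
  obtain ⟨ΩK, Ωp, L₂, hΩK, hΩp, hL⟩ := h
  obtain ⟨μ₀, hμ₀⟩ := IsAlgClosed.exists_pow_nat_eq c₀ (by norm_num : 0 < 2)
  have hμ₀ne : μ₀ ≠ 0 := by
    rintro rfl
    exact hc₀ (by rw [← hμ₀]; simp)
  have hμ : ((μ₀ : ℂ_[p])) ^ 2 = (c₀ : ℂ_[p]) := by
    rw [← hμ₀]
    exact (map_pow (UniformSpace.Completion.coeRingHom (α := PadicAlgCl p)) μ₀ 2).symm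
  refine ⟨ΩK, (μ₀ : ℂ_[p]) * Ωp, L₂, hΩK, mul_ne_zero ?_ hΩp, hL.of_sq_eq hμ⟩
  exact (map_ne_zero (UniformSpace.Completion.coeRingHom (α := PadicAlgCl p))).mpr hμ₀ne

/-! ## §3 The natural supply statement K3a♮ and the transfer K3a♮ ⇒ K3a (`stub_toricExists`, verbatim type) -/

/-- The TYPE of `ThinComb.stub_toricExists` (Lines/thin_comb.lean v5), verbatim. -/
def K3aStatement : Prop :=
    ∀ (W : WeierstrassCurve ℚ) [W.IsElliptic] [W.IsGloballyMinimal] (N : ℕ) [NeZero N] (K : Type) [Field K]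
      [NumberField K] (Dt : Literature.NumberTheory.EllipticCurves.ModularForms.ModularParametrizationData W N),
    Summit.BirchSwinnertonDyer.Rank1Residual.Additive.ClassO6 W 3 → W.HasSurjectiveModNGaloisRep 3 →
    W.analyticRank = 1 → W.conductorNorm ℤ = N → IsImaginaryQuadratic K → SatisfiesHeegnerHypothesis N K →
    ∀ (κ : ZpExtension K 3), κ.IsAnticyclotomic → ∀ (γ : Field.absoluteGaloisGroup K) [Fact (κ.IsTopGenerator γ)]
      (𝔭 : HeightOneSpectrum (𝓞 K)), ((3 : ℕ) : 𝓞 K) ∈ 𝔭.asIdeal →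
      𝔭.asIdeal.ramificationIdx (𝓞 ℚ) = 1 → 𝔭.asIdeal.inertiaDeg (𝓞 ℚ) = 1 →
    ∀ (𝔭' : HeightOneSpectrum (𝓞 K)), ((3 : ℕ) : 𝓞 K) ∈ 𝔭'.asIdeal → 𝔭' ≠ 𝔭 →
    ∀ (ι' : PadicAlgCl 3 ≃+* ℂ), Summit.BirchSwinnertonDyer.BirchSwinnertonDyer.Theorems.SchneiderFree.BranchInducesPrime 3 ι' 𝔭 →
    ∀ (κ₁ κ₂ : ZpExtension K 3) (γ₁ γ₂ : Field.absoluteGaloisGroup K) (k : ℕ)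
      [Fact (ZpExtension.IsTopGeneratorPair κ₁ κ₂ γ₁ γ₂)],
    (∀ v : HeightOneSpectrum (𝓞 K), v ≠ 𝔭 → ∀ 𝔓 ∈ v.primesAbove,
        𝔓.inertia (Field.absoluteGaloisGroup K) ≤ κ₁.kerSubgroup) →
    ZpExtension.pairKer κ₁ κ₂ ≤ κ.kerSubgroup → γ₁ * γ⁻¹ ∈ κ.kerSubgroup → γ₂ * (γ ^ (3 ^ k))⁻¹ ∈ κ.kerSubgroup →
    ∃ (ΩK' : ℂ) (Ωp' : ℂ_[3]) (L₂ : PowerSeries (PowerSeries (unrIntegers 3))),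
      ΩK' ≠ 0 ∧ Ωp' ≠ 0 ∧ IsToricTwoVarLFunction ι' 𝔭 𝔭' κ₁ κ₂ γ₁ γ₂ Dt.f ΩK' Ωp' L₂

/-- **K3a♮ — the NATURAL (ε-normalised) toric supply**: same frame binders as K3a, conclusion: a bounded
`L₂ ∈ Λ_unr` and a constant `c₀ ∈ ℚ̄_p^×` exist with the SCALED interpolation property at some period pair.  This is
what the `𝛉`-dominant Hida–Rankin–Selberg machine with the FIXED supercuspidal new vector `f_E` is expected to
output at the additive `3` (after multiplying by the unit `w_3[σ̄]^{f_3}`), with `c₀ = 3^{f_3/2}`, `f_3 = ord_3 N ∈ {3,4,5}`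
(memo §F2 + Marannino's local factor). [cite: Marannino2025, Prop. 1.1, Prop. 5.11–5.12, Remark 27 (arXiv:2312.06565)]
[cite: CastellaWan2023, §2.4 Thm. 2.11 (arXiv:1607.02019)] -/
def K3aScaled : Prop :=
    ∀ (W : WeierstrassCurve ℚ) [W.IsElliptic] [W.IsGloballyMinimal] (N : ℕ) [NeZero N] (K : Type) [Field K]
      [NumberField K] (Dt : Literature.NumberTheory.EllipticCurves.ModularForms.ModularParametrizationData W N),
    Summit.BirchSwinnertonDyer.Rank1Residual.Additive.ClassO6 W 3 → W.HasSurjectiveModNGaloisRep 3 →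
    W.analyticRank = 1 → W.conductorNorm ℤ = N → IsImaginaryQuadratic K → SatisfiesHeegnerHypothesis N K →
    ∀ (κ : ZpExtension K 3), κ.IsAnticyclotomic → ∀ (γ : Field.absoluteGaloisGroup K) [Fact (κ.IsTopGenerator γ)]
      (𝔭 : HeightOneSpectrum (𝓞 K)), ((3 : ℕ) : 𝓞 K) ∈ 𝔭.asIdeal →
      𝔭.asIdeal.ramificationIdx (𝓞 ℚ) = 1 → 𝔭.asIdeal.inertiaDeg (𝓞 ℚ) = 1 →
    ∀ (𝔭' : HeightOneSpectrum (𝓞 K)), ((3 : ℕ) : 𝓞 K) ∈ 𝔭'.asIdeal → 𝔭' ≠ 𝔭 →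
    ∀ (ι' : PadicAlgCl 3 ≃+* ℂ), Summit.BirchSwinnertonDyer.BirchSwinnertonDyer.Theorems.SchneiderFree.BranchInducesPrime 3 ι' 𝔭 →
    ∀ (κ₁ κ₂ : ZpExtension K 3) (γ₁ γ₂ : Field.absoluteGaloisGroup K) (k : ℕ)
      [Fact (ZpExtension.IsTopGeneratorPair κ₁ κ₂ γ₁ γ₂)],
    (∀ v : HeightOneSpectrum (𝓞 K), v ≠ 𝔭 → ∀ 𝔓 ∈ v.primesAbove,
        𝔓.inertia (Field.absoluteGaloisGroup K) ≤ κ₁.kerSubgroup) →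
    ZpExtension.pairKer κ₁ κ₂ ≤ κ.kerSubgroup → γ₁ * γ⁻¹ ∈ κ.kerSubgroup → γ₂ * (γ ^ (3 ^ k))⁻¹ ∈ κ.kerSubgroup →
    ∃ (ΩK' : ℂ) (Ωp' : ℂ_[3]) (L₂ : PowerSeries (PowerSeries (unrIntegers 3))) (c₀ : PadicAlgCl 3),
      ΩK' ≠ 0 ∧ Ωp' ≠ 0 ∧ c₀ ≠ 0 ∧
        IsToricTwoVarLFunctionScaled (c₀ : ℂ_[3]) ι' 𝔭 𝔭' κ₁ κ₂ γ₁ γ₂ Dt.f ΩK' Ωp' L₂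

/-- **K3a♮ ⇒ K3a** (period absorption; kernel-checked).  So the D1-CONE normalisation `𝓔 = 1` of K3a is the correct
demand at the supercuspidal `3` up to an admissible change of `Ω_p` — the natural ε-factor of the construction is
`(a+b)`-homogeneous (§2) and nothing else bounded can exist (§1, F1). -/
theorem K3a_of_K3aScaled (h : K3aScaled) : K3aStatement := by
  intro W _ _ N _ K _ _ Dt hO6 hsurj hrk hN hK hHeeg κ hκac γ _ 𝔭 h𝔭 he hf 𝔭' h𝔭' hne ι' hbr κ₁ κ₂ γ₁ γ₂ k _
    hunr hker hγ₁ hγ₂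
  obtain ⟨ΩK', Ωp', L₂, c₀, hΩK, hΩp, hc₀, hL⟩ :=
    h W N K Dt hO6 hsurj hrk hN hK hHeeg κ hκac γ 𝔭 h𝔭 he hf 𝔭' h𝔭' hne ι' hbr κ₁ κ₂ γ₁ γ₂ k hunr hker hγ₁ hγ₂
  exact exists_isToricTwoVarLFunction_of_scaled hc₀ ⟨ΩK', Ωp', L₂, hΩK, hΩp, hL⟩

end Summit.BirchSwinnertonDyer.BirchSwinnertonDyer.Cruxes.AdditiveSplitIMCInclusionAtThree.EpsilonSupply

end
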